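import Literature.AlgebraicGeometry.Motives.Differentials
import Mathlib.RingTheory.Etale.Kaehler
import HarnessLib

/-!
# Discharged fact: `Γ(U, Ω¹_{X/k}) = Ω_{Γ(X,U)/k}` on affine opens (Hartshorne II.8.9.2)

`Literature.AlgebraicGeometry.Motives.Differentials` records as a named fact
(`Literature.bijective_toCotangentSheaf_app : Prop`) that for a `k`-scheme `X` and an affine open
`U ⊆ X`, the component at `U` of the sheafification map from the presheaf `V ↦ Ω_{Γ(X,V)/k}`
(`Literature.kaehlerPresheaf X`) to the cotangent sheaf `Ω¹_{X/k}` (`Literature.cotangentSheaf X`, its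
sheafification) is bijective, i.e. `Γ(U, Ω¹_{X/k}) ≅ Ω_{Γ(X,U)/k}`. This is the affine
compatibility of the sheaf of differentials, R. Hartshorne, *Algebraic Geometry*, II, Remark 8.9.2
(`Ω_{X/Y}|_V ≅ (Ω_{B/A})~` for `V = Spec B` over `U = Spec A`), which in turn rests on the
localization formula `Ω_{S⁻¹B/A} ≅ S⁻¹Ω_{B/A}` (loc. cit., II, Prop. 8.2A) and on
`Γ(Spec A, M~) = M` (loc. cit., II, Prop. 5.1(d)). This file proves it
(`Literature.AlgebraicGeometry.Motives.bijective_toCotangentSheaf_app_holds`), and deduces the restatement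
`Literature.AlgebraicGeometry.Motives.nonempty_sections_cotangentSheaf_iso` (`Γ(U, Ω¹_{X/k}) ≃+ Ω_{Γ(X,U)/k}` for affine `U`) as
`Literature.AlgebraicGeometry.Motives.nonempty_sections_cotangentSheaf_iso_holds`: the inverse of the bijective sheafification map.

## Proof

We prove a general statement about a morphism `φ : M₀ ⟶ M` of presheaves of `𝒪_X`-modules on a
scheme `X` which is locally injective and locally surjective (e.g. a sheafification map) with `M`
separated, under the two "quasi-coherence on basic opens" hypotheses on `M₀`: for every affine
open `U` and `f ∈ Γ(X, U)`,
* (H1) a section of `M₀(U)` vanishing on `D(f)` is killed by a power of `f`;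
* (H2) every section of `M₀(D(f))` becomes, after multiplication by a power of `f`, the
  restriction of a section of `M₀(U)`.
Then `φ_U : M₀(U) → M(U)` is bijective for every affine open `U`
(`Literature.AlgebraicGeometry.Motives.bijective_app_of_isAffineOpen`):
* injectivity (`injective_app_of_isAffineOpen`): if `φ_U m = 0`, local injectivity and (H1) give,
  around every point of `U`, some `f` with `f ^ n • m = 0`; these `f` generate the unit ideal
  (`IsAffineOpen.self_le_iSup_basicOpen_iff`), so `m = 0`
  (`Submodule.mem_of_span_eq_top_of_smul_pow_mem`);
* the torsion lemma (`exists_pow_smul_eq_zero_of_map_basicOpen_eq_zero`, Hartshorne II.5.3(a) for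
  `M`): a section `t ∈ M(U)` vanishing on `D(f)` is killed by a power of `f` — local surjectivity,
  (H2), injectivity on `D(fg)` and (H1) show that `f ^ a • t` vanishes on the members `D(g)` of a
  basic open cover, finitely many of which cover `U` (`Ideal.span_eq_top_iff_finite`), and `M` is
  separated;
* surjectivity (`surjective_app_of_isAffineOpen`): for `s ∈ M(U)`, local surjectivity and (H2)
  give around every point some `f`, `n`, `q ∈ M₀(U)` with `φ_U q - f ^ n • s` vanishing on `D(f)`,
  hence killed by `f ^ N`; so `f ^ (N+n) • s ∈ im φ_U` and again these `f` generate the unit ideal.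
For `M₀ = kaehlerPresheaf X` the restriction map `Ω_{Γ(U)/k} → Ω_{Γ(D(f))/k}` is Mathlib's
`KaehlerDifferential.map`, a localization at `f` (`isLocalizedModule_kaehlerPresheaf_map`, from
`KaehlerDifferential.isLocalizedModule_map`, i.e. Hartshorne II.8.2A, since `Γ(D(f)) = Γ(U)_f`,
`IsAffineOpen.isLocalization_basicOpen`), which gives (H1) and (H2).

## References

* R. Hartshorne, *Algebraic Geometry*, GTM 52, Springer (1977), doi:10.1007/978-1-4757-3849-0,
  II Prop. 5.1(c),(d) and Lemma 5.3 (§II.5), Prop. 8.2A and Remark 8.9.2 (§II.8). [Hartshorne1977]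
-/

open CategoryTheory AlgebraicGeometry Opposite TopologicalSpace

universe u

namespace Literature.AlgebraicGeometry.Motives

/-! ### Covering sieves on affine opens and basic opens -/

section Sieves

variable {X : Scheme.{u}}

/-- Any two morphisms `op U ⟶ op V` in `(X.Opens)ᵒᵖ` are equal. [folklore] -/
theorem opens_op_hom_ext {U V : X.Opens} (i j : op U ⟶ op V) : i = j :=
  Quiver.Hom.unop_inj (Subsingleton.elim _ _)

/-- A covering sieve of an affine open `U` contains, around each point of `U`, a basic open
`D(f)`, `f ∈ Γ(X, U)` (basic opens form a basis of `U`). [folklore] -/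
theorem exists_basicOpen_of_mem_grothendieckTopology {U : X.Opens} (hU : IsAffineOpen U)
    {S : Sieve U} (hS : S ∈ Opens.grothendieckTopology X U) {x : X} (hx : x ∈ U) :
    ∃ f : Γ(X, U), x ∈ X.basicOpen f ∧ S (homOfLE (X.basicOpen_le f)) := by
  obtain ⟨V, g, hg, hxV⟩ := hS x hx
  obtain ⟨f, hfV, hxf⟩ := hU.exists_basicOpen_le ⟨x, hxV⟩ hx
  refine ⟨f, hxf, ?_⟩
  have := S.downward_closed hg (homOfLE hfV)
  rwa [Subsingleton.elim (homOfLE hfV ≫ g) (homOfLE (X.basicOpen_le f))] at this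

/-- If every point of an affine open `U` lies in `D(f)` for some `f ∈ s ⊆ Γ(X, U)`, then `s`
generates the unit ideal. [folklore] -/
theorem span_eq_top_of_forall_mem_basicOpen {U : X.Opens} (hU : IsAffineOpen U)
    {s : Set Γ(X, U)} (h : ∀ x ∈ U, ∃ f ∈ s, x ∈ X.basicOpen f) : Ideal.span s = ⊤ :=
  hU.self_le_iSup_basicOpen_iff.mp fun x hx => by
    obtain ⟨f, hf, hxf⟩ := h x hx
    exact Opens.mem_iSup.mpr ⟨⟨f, hf⟩, hxf⟩

end Sieves

/-! ### Sections of locally bijective maps of presheaves of modules on affine opens -/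

section General

-- `TopCat.Presheaf`/`TopCat.Sheaf` are not reducible: as in Mathlib's `AlgebraicGeometry.Modules`.
set_option backward.isDefEq.respectTransparency false

variable {X : Scheme.{u}} {M₀ M : X.PresheafOfModules} (φ : M₀ ⟶ M)

/-- **Injectivity on affine opens.** Let `φ : M₀ ⟶ M` be a locally injective morphism of
presheaves of `𝒪_X`-modules such that (H1) on every affine open `U`, a section of `M₀(U)`
vanishing on a basic open `D(f)` is killed by a power of `f`. Then `φ_U` is injective for every
affine open `U`. (The argument of Hartshorne, *Algebraic Geometry*, II.5.1/II.5.3 for `M~`.)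
[folklore] -/
theorem injective_app_of_isAffineOpen
    [PresheafOfModules.IsLocallyInjective (Opens.grothendieckTopology X) φ]
    (h₁ : ∀ ⦃U : X.Opens⦄, IsAffineOpen U → ∀ (f : Γ(X, U)) (m : M₀.obj (op U)),
      M₀.map (homOfLE (X.basicOpen_le f)).op m = 0 → ∃ n : ℕ, f ^ n • m = 0)
    {U : X.Opens} (hU : IsAffineOpen U) : Function.Injective (φ.app (op U)) := by
  intro m₁ m₂ hm
  rw [← sub_eq_zero]
  have hm0 : φ.app (op U) (m₁ - m₂) = 0 := by rw [map_sub, sub_eq_zero]; exact hm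
  have hS := Presheaf.equalizerSieve_mem (Opens.grothendieckTopology X)
    ((PresheafOfModules.toPresheaf _).map φ) (m₁ - m₂) 0
      (by change φ.app (op U) (m₁ - m₂) = φ.app (op U) 0; rw [hm0, map_zero])
  rw [← Submodule.mem_bot Γ(X, U)]
  refine Submodule.mem_of_span_eq_top_of_smul_pow_mem _ _
    (span_eq_top_of_forall_mem_basicOpen hU
      (s := {f | ∃ n : ℕ, f ^ n • (m₁ - m₂) = 0}) ?_) _ ?_
  · intro x hx
    obtain ⟨f, hxf, hf⟩ := exists_basicOpen_of_mem_grothendieckTopology hU hS hx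
    refine ⟨f, h₁ hU f _ ?_, hxf⟩
    have hf' : M₀.map (homOfLE (X.basicOpen_le f)).op (m₁ - m₂) =
        M₀.map (homOfLE (X.basicOpen_le f)).op 0 := hf
    rwa [map_zero] at hf'
  · rintro ⟨f, n, hn⟩
    exact ⟨n, by simpa using hn⟩

/-- **Torsion lemma** (Hartshorne, *Algebraic Geometry*, II.5.3(a), for the target of a locally
bijective map). Let `φ : M₀ ⟶ M` be locally injective and locally surjective with `M` separated,
and assume (H1) and (H2): on every affine open `U`, every section of `M₀(D(f))` becomes the
restriction of a section of `M₀(U)` after multiplication by a power of `f`. If `U` is affine,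
`f ∈ Γ(X, U)` and `t ∈ M(U)` vanishes on `D(f)`, then `f ^ N • t = 0` for some `N`. [folklore] -/
theorem exists_pow_smul_eq_zero_of_map_basicOpen_eq_zero
    (hM : Presheaf.IsSeparated (Opens.grothendieckTopology X) M.presheaf)
    [PresheafOfModules.IsLocallyInjective (Opens.grothendieckTopology X) φ]
    [PresheafOfModules.IsLocallySurjective (Opens.grothendieckTopology X) φ]
    (h₁ : ∀ ⦃U : X.Opens⦄, IsAffineOpen U → ∀ (f : Γ(X, U)) (m : M₀.obj (op U)),
      M₀.map (homOfLE (X.basicOpen_le f)).op m = 0 → ∃ n : ℕ, f ^ n • m = 0)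
    (h₂ : ∀ ⦃U : X.Opens⦄, IsAffineOpen U → ∀ (f : Γ(X, U))
      (y : M₀.obj (op (X.basicOpen f))), ∃ (n : ℕ) (x : M₀.obj (op U)),
        X.presheaf.map (homOfLE (X.basicOpen_le f)).op f ^ n • y =
          M₀.map (homOfLE (X.basicOpen_le f)).op x)
    {U : X.Opens} (hU : IsAffineOpen U) (f : Γ(X, U)) (t : M.obj (op U))
    (ht : M.map (homOfLE (X.basicOpen_le f)).op t = 0) : ∃ N : ℕ, f ^ N • t = 0 := by
  -- the `g` such that some `f ^ a • t` vanishes on `D(g)` generate the unit ideal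
  have hs : Ideal.span {g : Γ(X, U) | ∃ a : ℕ,
      M.map (homOfLE (X.basicOpen_le g)).op (f ^ a • t) = 0} = ⊤ := by
    apply span_eq_top_of_forall_mem_basicOpen hU
    intro x hx
    obtain ⟨g, hxg, t₀, ht₀⟩ := exists_basicOpen_of_mem_grothendieckTopology hU
      (Presheaf.imageSieve_mem (Opens.grothendieckTopology X)
        ((PresheafOfModules.toPresheaf _).map φ) t) hx
    refine ⟨g, ?_, hxg⟩
    have ht₀' : φ.app _ t₀ = M.map (homOfLE (X.basicOpen_le g)).op t := ht₀
    obtain ⟨n, q, hq⟩ := h₂ hU g t₀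
    -- on `D(g)`, `φ_U q` and `g ^ n • t` agree
    have key : M.map (homOfLE (X.basicOpen_le g)).op (φ.app _ q) =
        M.map (homOfLE (X.basicOpen_le g)).op (g ^ n • t) := by
      rw [← PresheafOfModules.naturality_apply, ← hq, (φ.app _).hom.map_smul, ht₀',
        PresheafOfModules.map_smul, map_pow]
      rfl
    -- restrict to `W = D(fg) = D(f) ∩ D(g)`, where `t` vanishes: there `φ q = 0`, so `q = 0`
    have hWf : X.basicOpen (f * g) ≤ X.basicOpen f := by
      rw [Scheme.basicOpen_mul]; exact inf_le_left
    have hWg : X.basicOpen (f * g) ≤ X.basicOpen g := by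
      rw [Scheme.basicOpen_mul]; exact inf_le_right
    have hqW : M₀.map (homOfLE (X.basicOpen_le (f * g))).op q = 0 := by
      apply injective_app_of_isAffineOpen φ h₁ (hU.basicOpen (f * g))
      rw [map_zero, PresheafOfModules.naturality_apply,
        opens_op_hom_ext (homOfLE (X.basicOpen_le (f * g))).op
          ((homOfLE (X.basicOpen_le g)).op ≫ (homOfLE hWg).op),
        PresheafOfModules.map_comp_apply, key, ← PresheafOfModules.map_comp_apply,
        opens_op_hom_ext ((homOfLE (X.basicOpen_le g)).op ≫ (homOfLE hWg).op)
          ((homOfLE (X.basicOpen_le f)).op ≫ (homOfLE hWf).op),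
        PresheafOfModules.map_comp_apply, PresheafOfModules.map_smul, ht, smul_zero, map_zero]
    obtain ⟨a, ha⟩ := h₁ hU (f * g) q hqW
    refine ⟨a, ?_⟩
    -- apply `φ` and restrict to `D(g)`, where `g` is a unit
    have h3 : M.map (homOfLE (X.basicOpen_le g)).op ((f * g) ^ a • φ.app _ q) = 0 := by
      rw [← (φ.app _).hom.map_smul]
      change M.map _ (φ.app _ ((f * g) ^ a • q)) = 0
      rw [ha, map_zero, map_zero]
    have h4 : (f * g) ^ a * g ^ n = g ^ (a + n) * f ^ a := by ring
    rw [PresheafOfModules.map_smul, key, ← PresheafOfModules.map_smul, smul_smul, h4,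
      ← smul_smul, PresheafOfModules.map_smul, map_pow] at h3
    exact ((X.toRingedSpace.isUnit_res_basicOpen g).pow (a + n)).smul_eq_zero.mp h3
  -- finitely many such `g` suffice; take the largest exponent and use that `M` is separated
  obtain ⟨T, hTs, hT⟩ := (Ideal.span_eq_top_iff_finite _).mp hs
  choose a ha using fun g : T => hTs g.2
  -- the covering sieve of opens contained in some `D(g)`, `g ∈ T`
  let S : Sieve U :=
    { arrows := fun W _ => ∃ g ∈ T, W ≤ X.basicOpen g
      downward_closed := by
        rintro W W' i ⟨g, hg, hW⟩ j
        exact ⟨g, hg, j.le.trans hW⟩ }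
  have hS : S ∈ Opens.grothendieckTopology X U := fun x hx => by
    obtain ⟨⟨g, hg⟩, hxg⟩ := Opens.mem_iSup.mp (hU.self_le_iSup_basicOpen_iff.mpr hT hx)
    exact ⟨X.basicOpen g, homOfLE (X.basicOpen_le g), ⟨g, hg, le_rfl⟩, hxg⟩
  refine ⟨Finset.univ.sup a, hM U S hS _ _ ?_⟩
  rintro W i ⟨g, hg, hWg⟩
  change M.map i.op _ = M.map i.op 0
  rw [map_zero, opens_op_hom_ext i.op ((homOfLE (X.basicOpen_le g)).op ≫ (homOfLE hWg).op),
    PresheafOfModules.map_comp_apply,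
    ← Nat.sub_add_cancel (Finset.le_sup (f := a) (Finset.mem_univ ⟨g, hg⟩)), pow_add,
    mul_smul, PresheafOfModules.map_smul, ha ⟨g, hg⟩, smul_zero, map_zero]

/-- **Surjectivity on affine opens.** Under the hypotheses of the torsion lemma
(`φ : M₀ ⟶ M` locally injective and locally surjective, `M` separated, (H1), (H2)),
`φ_U : M₀(U) → M(U)` is surjective for every affine open `U`.
(The argument of Hartshorne, *Algebraic Geometry*, II.5.1(d): `Γ(Spec A, M~) = M`.) [folklore] -/
theorem surjective_app_of_isAffineOpen
    (hM : Presheaf.IsSeparated (Opens.grothendieckTopology X) M.presheaf)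
    [PresheafOfModules.IsLocallyInjective (Opens.grothendieckTopology X) φ]
    [PresheafOfModules.IsLocallySurjective (Opens.grothendieckTopology X) φ]
    (h₁ : ∀ ⦃U : X.Opens⦄, IsAffineOpen U → ∀ (f : Γ(X, U)) (m : M₀.obj (op U)),
      M₀.map (homOfLE (X.basicOpen_le f)).op m = 0 → ∃ n : ℕ, f ^ n • m = 0)
    (h₂ : ∀ ⦃U : X.Opens⦄, IsAffineOpen U → ∀ (f : Γ(X, U))
      (y : M₀.obj (op (X.basicOpen f))), ∃ (n : ℕ) (x : M₀.obj (op U)),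
        X.presheaf.map (homOfLE (X.basicOpen_le f)).op f ^ n • y =
          M₀.map (homOfLE (X.basicOpen_le f)).op x)
    {U : X.Opens} (hU : IsAffineOpen U) : Function.Surjective (φ.app (op U)) := by
  intro s
  suffices hs : s ∈ LinearMap.range (φ.app (op U)).hom by
    obtain ⟨x, hx⟩ := LinearMap.mem_range.mp hs
    exact ⟨x, hx⟩
  refine Submodule.mem_of_span_eq_top_of_smul_pow_mem _ _
    (span_eq_top_of_forall_mem_basicOpen hU
      (s := {f | ∃ n : ℕ, f ^ n • s ∈ LinearMap.range (φ.app (op U)).hom}) ?_) s ?_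
  · intro x hx
    obtain ⟨f, hxf, t₀, ht₀⟩ := exists_basicOpen_of_mem_grothendieckTopology hU
      (Presheaf.imageSieve_mem (Opens.grothendieckTopology X)
        ((PresheafOfModules.toPresheaf _).map φ) s) hx
    refine ⟨f, ?_, hxf⟩
    have ht₀' : φ.app _ t₀ = M.map (homOfLE (X.basicOpen_le f)).op s := ht₀
    obtain ⟨n, q, hq⟩ := h₂ hU f t₀
    have key : M.map (homOfLE (X.basicOpen_le f)).op (φ.app _ q - f ^ n • s) = 0 := by
      rw [map_sub, ← PresheafOfModules.naturality_apply, ← hq, (φ.app _).hom.map_smul, ht₀',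
        PresheafOfModules.map_smul, map_pow, sub_eq_zero]
      rfl
    obtain ⟨N, hN⟩ :=
      exists_pow_smul_eq_zero_of_map_basicOpen_eq_zero φ hM h₁ h₂ hU f _ key
    refine ⟨N + n, f ^ N • q, ?_⟩
    rw [smul_sub, sub_eq_zero, smul_smul, ← pow_add] at hN
    rw [map_smul, hN]
  · rintro ⟨f, n, hn⟩
    exact ⟨n, hn⟩

/-- **Bijectivity on affine opens** of a locally bijective morphism `φ : M₀ ⟶ M` of presheaves
of `𝒪_X`-modules with separated target whose source is "quasi-coherent on basic opens"
((H1) and (H2)); in particular of the sheafification map of such an `M₀`.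
(Hartshorne, *Algebraic Geometry*, II.5.1: `Γ(D(f), M~) = M_f`, `Γ(Spec A, M~) = M`.)
[folklore] -/
theorem bijective_app_of_isAffineOpen
    (hM : Presheaf.IsSeparated (Opens.grothendieckTopology X) M.presheaf)
    [PresheafOfModules.IsLocallyInjective (Opens.grothendieckTopology X) φ]
    [PresheafOfModules.IsLocallySurjective (Opens.grothendieckTopology X) φ]
    (h₁ : ∀ ⦃U : X.Opens⦄, IsAffineOpen U → ∀ (f : Γ(X, U)) (m : M₀.obj (op U)),
      M₀.map (homOfLE (X.basicOpen_le f)).op m = 0 → ∃ n : ℕ, f ^ n • m = 0)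
    (h₂ : ∀ ⦃U : X.Opens⦄, IsAffineOpen U → ∀ (f : Γ(X, U))
      (y : M₀.obj (op (X.basicOpen f))), ∃ (n : ℕ) (x : M₀.obj (op U)),
        X.presheaf.map (homOfLE (X.basicOpen_le f)).op f ^ n • y =
          M₀.map (homOfLE (X.basicOpen_le f)).op x)
    {U : X.Opens} (hU : IsAffineOpen U) : Function.Bijective (φ.app (op U)) :=
  ⟨injective_app_of_isAffineOpen φ h₁ hU, surjective_app_of_isAffineOpen φ hM h₁ h₂ hU⟩

end General

/-! ### The presheaf of Kähler differentials is a localization on basic opens -/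

section Kaehler

-- `TopCat.Presheaf`/`TopCat.Sheaf` are not reducible: as in Mathlib's `AlgebraicGeometry.Modules`.
set_option backward.isDefEq.respectTransparency false

variable {k : Type u} [CommRing k] (X : Over (Spec (CommRingCat.of k)))

/-- On an affine open `U` of a `k`-scheme `X`, the restriction map
`Ω_{Γ(X,U)/k} → Ω_{Γ(X,D(f))/k}` of the presheaf `U ↦ Ω_{Γ(X,U)/k}` is a localization at `f`:
it is Mathlib's functoriality map `KaehlerDifferential.map` (for the `k`-algebra structures
`k ≅ Γ(Spec k) → Γ(X, X) → Γ(X, U)` given by `constToPresheaf`, compatible with restriction),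
and `Ω_{Γ(D(f))/k} = Ω_{Γ(U)_f/k} = (Ω_{Γ(U)/k})_f` (Hartshorne, *Algebraic Geometry*, II.8.2A;
Mathlib's `KaehlerDifferential.isLocalizedModule_map` and `IsAffineOpen.isLocalization_basicOpen`).
[cite: Hartshorne1977, II Prop. 8.2A] -/
theorem isLocalizedModule_kaehlerPresheaf_map ⦃U : X.left.Opens⦄ (hU : IsAffineOpen U)
    (f : Γ(X.left, U)) :
    ∃ l : (kaehlerPresheaf X).obj (op U) →ₗ[Γ(X.left, U)]
        (ModuleCat.restrictScalars (X.left.ringCatSheaf.obj.map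
          (homOfLE (X.left.basicOpen_le f)).op).hom).obj
          ((kaehlerPresheaf X).obj (op (X.left.basicOpen f))),
      IsLocalizedModule (Submonoid.powers f) l ∧
        ∀ x, l x = (kaehlerPresheaf X).map (homOfLE (X.left.basicOpen_le f)).op x := by
  -- the `k`-algebra structures on `Γ(X, U)`, `Γ(X, D(f))` and the tower `k → Γ(U) → Γ(D(f))`
  letI algU : Algebra k Γ(X.left, U) :=
    (((constToPresheaf X).app (op U)).hom : k →+* Γ(X.left, U)).toAlgebra
  letI algV : Algebra k Γ(X.left, X.left.basicOpen f) :=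
    (((constToPresheaf X).app (op (X.left.basicOpen f))).hom :
      k →+* Γ(X.left, X.left.basicOpen f)).toAlgebra
  haveI : IsScalarTower k Γ(X.left, U) Γ(X.left, X.left.basicOpen f) := by
    refine IsScalarTower.of_algebraMap_eq fun x => ?_
    have h := CategoryTheory.congr_fun
      ((constToPresheaf X).naturality (homOfLE (X.left.basicOpen_le f)).op) x
    simp only [Functor.const_obj_map, CommRingCat.comp_apply] at h
    exact h
  haveI := hU.isLocalization_basicOpen f
  exact ⟨((kaehlerPresheaf X).map (homOfLE (X.left.basicOpen_le f)).op).hom,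
    inferInstanceAs (IsLocalizedModule (Submonoid.powers f)
      (KaehlerDifferential.map k k Γ(X.left, U) Γ(X.left, X.left.basicOpen f))),
    fun x => rfl⟩

/-- (H1) for `U ↦ Ω_{Γ(X,U)/k}`: on an affine open `U`, a Kähler differential vanishing on `D(f)`
is killed by a power of `f`, because `Ω_{Γ(D(f))/k} = (Ω_{Γ(U)/k})_f`
(Hartshorne, *Algebraic Geometry*, II.8.2A). [cite: Hartshorne1977, II Prop. 8.2A] -/
theorem kaehlerPresheaf_exists_pow_smul_eq_zero ⦃U : X.left.Opens⦄ (hU : IsAffineOpen U)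
    (f : Γ(X.left, U)) (m : (kaehlerPresheaf X).obj (op U))
    (hm : (kaehlerPresheaf X).map (homOfLE (X.left.basicOpen_le f)).op m = 0) :
    ∃ n : ℕ, f ^ n • m = 0 := by
  obtain ⟨l, hl, hl'⟩ := isLocalizedModule_kaehlerPresheaf_map X hU f
  rw [← hl'] at hm
  obtain ⟨⟨_, n, rfl⟩, hn⟩ := IsLocalizedModule.exists_of_eq (S := Submonoid.powers f) (f := l)
    (hm.trans (map_zero l).symm)
  exact ⟨n, by simpa [Submonoid.smul_def] using hn⟩

/-- (H2) for `U ↦ Ω_{Γ(X,U)/k}`: on an affine open `U`, every Kähler differential on `D(f)`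
becomes the restriction of one on `U` after multiplication by a power of `f`, because
`Ω_{Γ(D(f))/k} = (Ω_{Γ(U)/k})_f` (Hartshorne, *Algebraic Geometry*, II.8.2A).
[cite: Hartshorne1977, II Prop. 8.2A] -/
theorem kaehlerPresheaf_exists_pow_smul_eq_map ⦃U : X.left.Opens⦄ (hU : IsAffineOpen U)
    (f : Γ(X.left, U)) (y : (kaehlerPresheaf X).obj (op (X.left.basicOpen f))) :
    ∃ (n : ℕ) (x : (kaehlerPresheaf X).obj (op U)),
      X.left.presheaf.map (homOfLE (X.left.basicOpen_le f)).op f ^ n • y =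
        (kaehlerPresheaf X).map (homOfLE (X.left.basicOpen_le f)).op x := by
  obtain ⟨l, hl, hl'⟩ := isLocalizedModule_kaehlerPresheaf_map X hU f
  obtain ⟨⟨x, s⟩, hx⟩ := IsLocalizedModule.surj (Submonoid.powers f) l y
  obtain ⟨n, hn⟩ := (Submonoid.mem_powers_iff _ _).mp s.2
  refine ⟨n, x, ?_⟩
  dsimp only at hx
  rw [← hl', ← hx, Submonoid.smul_def, ← hn, ← map_pow]
  rfl

/-- The sheafification map `toCotangentSheaf X` is locally injective. [folklore] -/
theorem isLocallyInjective_toCotangentSheaf :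
    PresheafOfModules.IsLocallyInjective (Opens.grothendieckTopology X.left)
      (toCotangentSheaf X) :=
  inferInstanceAs
    (Presheaf.IsLocallyInjective _ (toSheafify _ (kaehlerPresheaf X).presheaf))

/-- The sheafification map `toCotangentSheaf X` is locally surjective. [folklore] -/
theorem isLocallySurjective_toCotangentSheaf :
    PresheafOfModules.IsLocallySurjective (Opens.grothendieckTopology X.left)
      (toCotangentSheaf X) :=
  inferInstanceAs
    (Presheaf.IsLocallySurjective _ (toSheafify _ (kaehlerPresheaf X).presheaf))

/-- **Discharge of `bijective_toCotangentSheaf_app`** (Hartshorne, *Algebraic Geometry*,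
II.8.9.2: `Ω_{X/Y}|_V ≅ (Ω_{B/A})~` for an affine open `V = Spec B`, here with `Y = Spec k`;
together with II.5.1(d), `Γ(Spec B, M~) = M`): for an affine open `U` of a `k`-scheme `X`, the
canonical map `Ω_{Γ(X,U)/k} → Γ(U, Ω¹_{X/k})` (the component at `U` of the sheafification map)
is bijective. Proof: `bijective_app_of_isAffineOpen` applied to the sheafification map, whose
hypotheses (H1), (H2) hold because `Ω_{Γ(D(f))/k} = (Ω_{Γ(U)/k})_f` (II.8.2A).
[cite: Hartshorne1977, II Remark 8.9.2] -/
theorem bijective_toCotangentSheaf_app_holds : bijective_toCotangentSheaf_app X := by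
  intro U hU
  haveI := isLocallyInjective_toCotangentSheaf X
  haveI := isLocallySurjective_toCotangentSheaf X
  exact bijective_app_of_isAffineOpen (toCotangentSheaf X) (cotangentSheaf X).isSheaf.isSeparated
    (kaehlerPresheaf_exists_pow_smul_eq_zero X) (kaehlerPresheaf_exists_pow_smul_eq_map X) hU

end Kaehler

/-! ### Sections of `Ω¹_{X/k}` on affine opens, as an additive equivalence -/

section KaehlerIso

variable {k : Type u} [CommRing k] (X : Over (Spec (CommRingCat.of k)))

/-- **Discharge of `nonempty_sections_cotangentSheaf_iso`** (Hartshorne, *Algebraic Geometry*,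
II.8.9.2: `Ω_{X/Y}|_V ≅ (Ω_{B/A})~` for an affine open `V = Spec B`, here with `Y = Spec k`, so
that `Γ(V, Ω_{X/k}) = Ω_{B/k}` by II.5.1(d)): for an affine open `U` of a `k`-scheme `X`,
`Γ(U, Ω¹_{X/k}) ≃+ Ω_{Γ(X,U)/k}`, namely the inverse of the sheafification map
`Ω_{Γ(X,U)/k} → Γ(U, Ω¹_{X/k})`, which is additive and bijective
(`bijective_toCotangentSheaf_app_holds`). [cite: Hartshorne1977, II Remark 8.9.2] -/
theorem nonempty_sections_cotangentSheaf_iso_holds : nonempty_sections_cotangentSheaf_iso X := by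
  intro U hU
  exact ⟨(AddEquiv.ofBijective ((toCotangentSheaf X).app (op U)).hom.toAddMonoidHom
    (bijective_toCotangentSheaf_app_holds X hU)).symm⟩

end KaehlerIso

end Literature.AlgebraicGeometry.Motives
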